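import Summits.ABC.StewartYu.ArchG3ScheduleD
import Summits.ABC.StewartYu.ArchG3LineEnd
import HarnessLib

/-!
# Cell abc-stewartyu, WP-L.A (crux r2 `ArchCoreRat`, stmt-ABC-20502), line `arch-g3-frame` v3: the START-level package `StartAt` on the
# D-GENERIC packs (virtual instances) and the content of the stub `stub_levelsArch` (plan g12 RULINGS R32 (c3), R38 (1), co-sign (bk2), R39 (a))

`Summits/ABC/StewartYu/ArchG3LineLevels.lean` — cell `abc-stewartyu` (HOME `run/shared/lean/pub/abc-stewartyu/`), route `YuMatveevShapeRat`
(rung A1.L), seat p4 (g9, registrar of the r2 line).  One plain `Prop`-valued definition and one theorem; no named fact.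

`ArchG3Line.StartAt c Y n a b A` is what the START (p1, with p5's packs) delivers for ONE reduced datum, in lp-1's D-generic vocabulary
(`ArchG3ScheduleD.lastLevelState_of_scheduleD`, binders verbatim): saturation data `(θ > 0, b̃, j̃₀, U, N ≥ 1)` with `θᵢ^N = ∏ aⱼ^{Uᵢⱼ}`,
`b̃ ᵥ* U = N·b`, `ν = (· ᵥ* U)` injective, `θ` with independent square classes; the extra invariant `Q` with its half-step hook `hQhalf`,
the virtual-box predicate `V` with `hQV : Q B v lev → ∀ i ∈ B, V lev (v i)` and its last-level reading `V Ŝ w → |ν(w)ⱼ| ≤ Bvⱼ`; the negated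
bound `|Λ̃/b̃_{j̃₀}| ≤ δ₀`; the halving laws; the level-`0` k-step packs `ArchKStepHypD … (V 0)`, and for each `lev < Ŝ` the half-step pack
`ArchHalfStepHypD … (V lev)`, the odd pack `ArchKStepOddHypD … (V (lev+1))` and the `n − 1` k-step packs `ArchKStepHypD … (V (lev+1))`; the
level-`(0,0)` state WITH `Q`; the END letters `ℓ₀ ≤ D₀` on `U`, `(n+1)X′ ≤ N Ŝ n`, `(n+1)S₀ < T Ŝ n`; and `RecordArchW (c^·) Y n A D₀ S₀ X′ Bv`.
`ArchG3Line.endAt_of_startAt` (the LEVELS stub's content verbatim): `StartAt ⇒ EndAt` (`lastLevelState_of_scheduleD` + `lastLevelInv_feldR`).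

WHAT THIS IS NOT: no START construction, no packs, no record (those DISCHARGE `StartAt`); no crux moves by itself.

References: Yu. V. Nesterenko, LNM 1819 (2003), §4 Prop. 4.1, §5.1 (p. 80–98).
-/

noncomputable section

open Finset
open scoped Matrix
open Summit.ABC.StewartYu.GenThreeFrameSpecArchW (RecordArchW)
open Summit.ABC.StewartYu.FeldmanBasis (feldR)
open Summit.ABC.StewartYu.ArchSupply (scaledFeldR)
open Summit.ABC.StewartYu.ArchG3FrameGlue (setupOf)

namespace Summit.ABC.StewartYu.ArchG3Line

/-- **What the START (with the record and the packs) delivers, for one reduced datum**, D-generic vocabulary (see the module docstring).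
[cite: Nesterenko2003, §3.5, §4 Prop. 4.1, §5.2; shape only] -/
def StartAt (c : ℝ) (Y : ℕ → ℝ) (n : ℕ) (a : Fin n → ℚ) (b : Fin n → ℤ) (A : Fin n → ℝ) : Prop :=
  ∃ (θ : Fin n → ℚ) (hθ : ∀ i, 0 < θ i) (bt : Fin n → ℤ) (jt : Fin n) (hjt : bt jt ≠ 0)
    (U : Matrix (Fin n) (Fin n) ℤ) (Nsat : ℕ)
    (Q : Finset (ℕ × (Fin n → ℤ)) → ((ℕ × (Fin n → ℤ)) → Fin n → ℤ) → ℕ → Prop) (V : ℕ → (Fin n → ℤ) → Prop)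
    (H Sh : ℕ) (s : Fin n → ℕ) (Uset : Finset (ℕ × (Fin n → ℤ))) (pv : (ℕ × (Fin n → ℤ)) → ℤ) (P : ℤ) (δ₀ : ℝ)
    (wl γb : ℕ → ℝ) (cl : ℕ → ℤ) (el : ℕ → Fin n → ℤ) (Nf Tf : ℕ → ℕ → ℕ) (Nh : ℕ → ℕ) (D₀ X' S₀ : ℕ) (Bv : Fin n → ℕ),
    1 ≤ Nsat ∧ (∀ i, θ i ^ Nsat = ∏ j, a j ^ U i j) ∧ bt ᵥ* U = (Nsat : ℤ) • b ∧
    (∀ w₁ w₂ : Fin n → ℤ, w₁ ᵥ* U = w₂ ᵥ* U → w₁ = w₂) ∧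
    (∀ T₁ : Finset (Fin n), T₁.Nonempty → ¬ IsSquare (∏ j ∈ T₁, θ j)) ∧
    |(setupOf n θ hθ bt jt hjt).Λ / (bt jt : ℝ)| ≤ δ₀ ∧
    (∀ (lev : ℕ) (B : Finset (ℕ × (Fin n → ℤ))) (v : (ℕ × (Fin n → ℤ)) → Fin n → ℤ) (i₀ : ℕ × (Fin n → ℤ)),
      i₀ ∈ B → Q B v lev → Q ((setupOf n θ hθ bt jt hjt).parityClass v B i₀) ((setupOf n θ hθ bt jt hjt).halfDiff v i₀) (lev + 1)) ∧
    (∀ (lev : ℕ) (B : Finset (ℕ × (Fin n → ℤ))) (v : (ℕ × (Fin n → ℤ)) → Fin n → ℤ), Q B v lev → ∀ i ∈ B, V lev (v i)) ∧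
    (∀ w₁ : Fin n → ℤ, V Sh w₁ → ∀ j, |(w₁ ᵥ* U) j| ≤ (Bv j : ℤ)) ∧
    (∀ lev, wl (lev + 1) = wl lev / 2) ∧ (∀ lev, wl lev / 2 ≤ γb (lev + 1)) ∧
    (∀ ν, ν < n → (setupOf n θ hθ bt jt hjt).ArchKStepHypD (fun i => scaledFeldR i.1 H (Sh - 0)) Uset
      ((setupOf n θ hθ bt jt hjt).Lb s 0) P (wl 0) (γb 0) (cl 0) (el 0) δ₀ (V 0) (Nf 0 ν) (Nf 0 (ν + 1)) (Tf 0 ν) (Tf 0 (ν + 1))) ∧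
    (∀ lev < Sh, (setupOf n θ hθ bt jt hjt).ArchHalfStepHypD (fun i => scaledFeldR i.1 H (Sh - lev))
      (fun i => scaledFeldR i.1 H (Sh - (lev + 1))) Uset ((setupOf n θ hθ bt jt hjt).Lb s lev) P (wl lev) (γb lev) (cl lev) (el lev)
      (cl (lev + 1)) δ₀ (V lev) (Nf lev n) (Nh (lev + 1)) (Tf lev n) (Tf (lev + 1) 0)) ∧
    (∀ lev < Sh, (setupOf n θ hθ bt jt hjt).ArchKStepOddHypD (fun i => scaledFeldR i.1 H (Sh - (lev + 1))) Uset
      ((setupOf n θ hθ bt jt hjt).Lb s (lev + 1)) P (wl (lev + 1)) (γb (lev + 1)) (cl (lev + 1)) (el (lev + 1)) δ₀ (V (lev + 1))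
      (Nh (lev + 1)) (Nf (lev + 1) 1) (Tf (lev + 1) 0) (Tf (lev + 1) 1)) ∧
    (∀ lev < Sh, ∀ ν, 1 ≤ ν → ν < n → (setupOf n θ hθ bt jt hjt).ArchKStepHypD (fun i => scaledFeldR i.1 H (Sh - (lev + 1))) Uset
      ((setupOf n θ hθ bt jt hjt).Lb s (lev + 1)) P (wl (lev + 1)) (γb (lev + 1)) (cl (lev + 1)) (el (lev + 1)) δ₀ (V (lev + 1))
      (Nf (lev + 1) ν) (Nf (lev + 1) (ν + 1)) (Tf (lev + 1) ν) (Tf (lev + 1) (ν + 1))) ∧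
    (setupOf n θ hθ bt jt hjt).ArchLevelStateQ Q H Sh s Uset pv P wl γb cl el 0 (Nf 0 0) (Tf 0 0) ∧
    (∀ i ∈ Uset, i.1 ≤ D₀) ∧ (n + 1) * X' ≤ Nf Sh n ∧ (n + 1) * S₀ < Tf Sh n ∧
    RecordArchW (fun r => c ^ r) Y n A D₀ S₀ X' Bv

/-- **THE LEVELS STUB's CONTENT (`stub_levelsArch` of line `arch-g3-frame`)**: `StartAt ⇒ EndAt` for every datum (`2 ≤ n`), by lp-1's
`lastLevelState_of_scheduleD` and `lastLevelInv_feldR`, reading the virtual box off `Q` at the last level. [cite: Nesterenko2003, §4 Prop. 4.1, p. 80–95] -/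
theorem endAt_of_startAt :
    ∀ (c : ℝ) (Y : ℕ → ℝ) (n : ℕ), 2 ≤ n → ∀ (a : Fin n → ℚ) (b : Fin n → ℤ) (A : Fin n → ℝ),
      StartAt c Y n a b A → EndAt c Y n a b A := by
  intro c Y n hn a b A hSt
  obtain ⟨θ, hθ, bt, jt, hjt, U, Nsat, Q, V, H, Sh, s, Uset, pv, P, δ₀, wl, γb, cl, el, Nf, Tf, Nh, D₀, X', S₀, Bv, hN, hU, hbU,
    hνinj, hindθ, hΛ, hQhalf, hQV, hVbox, hwl, hγb, hK0, hH, hO, hK, h00, hUdeg, hX, hS, hrec⟩ := hSt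
  have hn1 : 1 ≤ (setupOf n θ hθ bt jt hjt).n := by show 1 ≤ n; omega
  have hlast := ArchG3Setup.lastLevelState_of_scheduleD (S := setupOf n θ hθ bt jt hjt) hn1 hindθ hΛ hQhalf hQV Nf Tf Nh hwl hγb
    hK0 hH hO hK h00
  obtain ⟨B, v, lo, γ, hBU, hinj, hinv, hQ⟩ := ArchG3Setup.lastLevelInv_feldR hlast
  exact ⟨θ, hθ, bt, jt, hjt, U, Nsat, H, B, v, pv, lo, (setupOf n θ hθ bt jt hjt).Lb s Sh, P, wl Sh, γ, cl Sh, el Sh, Nf Sh n,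
    Tf Sh n, D₀, S₀, X', Bv, hN, hU, hbU, hνinj, hinv, fun i hi => hUdeg i (hBU hi), hinj,
    fun i hi => hVbox (v i) (hQV Sh B v hQ i hi), hX, hS, hrec⟩

end Summit.ABC.StewartYu.ArchG3Line

end
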